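import Summits.Ventures.GridStability.Bench.WSCC9SP9SlabORoa
import Literature.MathematicalPhysics.PowerSystems.LuriePostnikovSlabDecayRate

/-!
# GridStability/Bench/WSCC9SP9SlabORate — «G2.b-SP9-SLAB-RATE-OPT»: the OPTIMISED certified decay time constant on ★ #45's object and
# class (lineage O), one application of lit-6's class theorem BY NAME (follow-up of #94-cand «G2.b-SP9-SLAB-RATE»)

Cell `gridfusion` (LADDER-GRIDFUSION), SP–Lur'e lane; seat gridfusion-model-2 (g7); lead g6 RULING 7d booked #94 as «SUFFICIENT, NOT SHARP»
(time constant 8006 s on ★ #45's feasibility-grade certificate); this file carries the SAME sentence shape on the RATE-OPTIMISED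
certificate `Bench.WSCC9SP9SlabO.certO` (Bench/WSCC9SP9SlabORoa on Lyapunov/WSCC9SP9SlabOData; kit j280194): time constant
`2p₂/η = 267575/256 ≈ 1045 s` = 7.7× sharper, and — by the model-2 census (STATUS RUN 13:46:04Z: 1045 / 356 / 271 s at slab u = 1/4,
1/8, 1/16) — about the best this certificate CLASS gives at u = 1/4. NOT OF RECORD unless the lead books it. MODEL M′_D and the
MODELLED tokens = ★ #45 VERBATIM; CLASS C_O = the lineage-O certificate's OWN certified well (`|σ_e(0) − σ*_e| ≤ 97/200` on the 8
lines and `V_O(relState) ≤ cOQ = 442223/41943040000`, `V_O` = certO's form) — a NEW well: `cOQ < cQ` as numbers, but the two wells are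
sublevel sets of DIFFERENT Lyapunov functions and NO nesting with ★ #45's well C is claimed (ref-3 LEDGER-3 row 63 precision W1′: «same
OBJECT M′_D, same class SHAPE (slab u = 1/4, γ_lo = 97/200), a new certified well C_O, sharper rate, larger amplitude factor»). NEW DATA: `p₂ = p2OQ = 10703/1024` and the PSD fact
`p₂•1 − (P + Cᵀ·diag(λ)·C) ⪰ 0` of Lyapunov/WSCC9SP9SlabOData (`posSemidefO.2.2`). CLASS THEOREM: lit-6's
`SlabCertificate.sqrt_dotProduct_le_of_well` / `dotProduct_le_mul_exp_neg_of_well` [cite: Khalil2002, Theorem 4.10; Pai1981, §2.16 Theorem [18] eq. (2.63)].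
WHAT IS PROVED: `upperMatrixO_eq` / `UOQ_eq` (certO's upper matrix = cast of `POQ + CQᵀ·diag(lamOQ)·CQ` = `WOq` reindexed, kernel
decide), `upperO_posSemidef`, `hsecO` / `hfrO` (from ★ #45's instance facts `lineAngle_abs_le_theta`, `tauV1 < 1`, and certO's
`aO_le_slabSlope`, `oneO_le_b`, `hcO`), **`sp9O_slab_rate`**: for every phase solution `X` of M′_D from a point of C_O and every `t ≥ 0`,
`‖relState(X t)‖₂ ≤ √(p₂/ε)·‖relState(X 0)‖₂·e^{−(η/(2p₂))·t}` with `ε = 47/524288`, `η = 1/50`, `p₂ = 10703/1024` — certified TIME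
CONSTANT `267575/256 ≈ 1045` model-seconds, amplitude factor `√(5479936/47) ≈ 341`; `sp9O_slab_rate_sq` the squared form;
`rateO_constants`. SUFFICIENT, NOT SHARP; a property of the certificate CLASS (minutes at every slab width), not an estimate of the
model's damping. THREE COLUMNS. CERTIFIED: the matrix fact and the two rate sentences for MODEL M′_D and CLASS C_O. MODELLED: ★ #45
verbatim («MV-3 + lossless + MV-RD(0.046 @ slack G1) + D⟨declared: MV-SPD transplant machines, buses 1/10 synthetic⟩ + V-frozen(V1) + ω_R
= 377 printed + ref bus 9»). VALIDATED: the SDP sweep, any simulated decay of M′ (juxtaposed only). Never «the grid damps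
oscillations in T seconds».
-/


noncomputable section

open Set Filter Topology Real Matrix
open Literature.MathematicalPhysics.PowerSystems
open Literature.MathematicalPhysics.PowerSystems.LyapunovFunctionFamily
open Literature.Computation.Certificates
open Summit.Ventures.GridStability.Models
open Summit.Ventures.GridStability.Models.StructurePreserving
open Summit.Ventures.GridStability.Models.WSCC9SP
open Summit.Ventures.GridStability.Lyapunov.WSCC9SP9SlabO (p2OQ WOq lamOQ epsOQ etaOQ cOQ posSemidefO scalarsO)
open Summit.Ventures.GridStability.Bench.WSCC9SP9Slab (D hD e1 CQ C_eq)
open Summit.Ventures.GridStability.Bench.WSCC9SP9SlabO (POQ PO certO aO_le_slabSlope oneO_le_b hcO)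

namespace Summit.Ventures.GridStability.Bench.WSCC9SP9SlabORate

/-! ### The upper comparison matrix of ★ #45 is the Data file's `WOq` -/

/-- the lineage-O upper comparison matrix over `ℚ` on the state type: `POQ + CQᵀ·diag(lamOQ)·CQ` (`b ≡ 1`). -/
def UOQ : Matrix (Fin 8 ⊕ Fin 3) (Fin 8 ⊕ Fin 3) ℚ := POQ + CQᵀ * Matrix.diagonal lamOQ * CQ

/-- `UOQ` is the Data file's flattened `WOq` reindexed by `e1` (kernel). -/
theorem UOQ_eq : UOQ = WOq.submatrix e1 e1 := by
  decide +kernel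

/-- `(M·N) ↦ ℝ` = product of the casts (plumbing). -/
private theorem map_mul' {m n o : Type*} [Fintype n] (M : Matrix m n ℚ) (N : Matrix n o ℚ) :
    (M * N).map (Rat.cast : ℚ → ℝ) = M.map (Rat.cast : ℚ → ℝ) * N.map (Rat.cast : ℚ → ℝ) :=
  Matrix.map_mul (f := Rat.castHom ℝ)

/-- `(M+N) ↦ ℝ` = sum of the casts (plumbing). -/
private theorem map_add' {m n : Type*} (M N : Matrix m n ℚ) :
    (M + N).map (Rat.cast : ℚ → ℝ) = M.map (Rat.cast : ℚ → ℝ) + N.map (Rat.cast : ℚ → ℝ) := by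
  ext i j; simp

/-- transpose commutes with the cast (plumbing, `rfl`). -/
private theorem map_transpose' {m n : Type*} (M : Matrix m n ℚ) :
    Mᵀ.map (Rat.cast : ℚ → ℝ) = (M.map (Rat.cast : ℚ → ℝ))ᵀ := rfl

/-- `diag(d) ↦ ℝ = diag(d ↦ ℝ)` (plumbing). -/
private theorem map_diagonal' {n : Type*} [DecidableEq n] (d : n → ℚ) :
    (Matrix.diagonal d).map (Rat.cast : ℚ → ℝ) = Matrix.diagonal (fun i => (d i : ℝ)) :=
  Matrix.diagonal_map Rat.cast_zero

/-- **the lineage-O upper comparison matrix `PO + Cᵀ·diag(λ_k b_k)·C` is the cast of `UOQ`.** -/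
theorem upperMatrixO_eq : certO.upperMatrix = UOQ.map (Rat.cast : ℚ → ℝ) := by
  have hd : Matrix.diagonal (fun k => certO.lam k * certO.b k) = (Matrix.diagonal lamOQ).map (Rat.cast : ℚ → ℝ) := by
    rw [map_diagonal']
    congr 1; funext k
    show (lamOQ k : ℝ) * 1 = (lamOQ k : ℝ)
    ring
  rw [SlabCertificate.upperMatrix_def, hd, C_eq]
  show PO + _ = _
  rw [PO, UOQ]
  simp only [map_add', map_mul', map_transpose']

/-- **The rider's PSD fact on the state type**: `p₂•1 − (PO + Cᵀ·diag(λ_k b_k)·C) ⪰ 0` for the lineage-O certificate, `p₂ = 10703/1024`. -/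
theorem upperO_posSemidef :
    ((p2OQ : ℝ) • (1 : Matrix (Fin 8 ⊕ Fin 3) (Fin 8 ⊕ Fin 3) ℝ) - certO.upperMatrix).PosSemidef := by
  have h1 : (p2OQ : ℝ) • (1 : Matrix (Fin 8 ⊕ Fin 3) (Fin 8 ⊕ Fin 3) ℝ) - certO.upperMatrix
      = (((p2OQ • (1 : Matrix (Fin 11) (Fin 11) ℚ) - WOq)).map (Rat.cast : ℚ → ℝ)).submatrix e1 e1 := by
    rw [upperMatrixO_eq, UOQ_eq]
    ext i j
    by_cases h : i = j
    · subst h; simp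
    · have h' : e1 i ≠ e1 j := fun he => h (e1.injective he)
      simp [h, h']
  rw [h1]
  exact (Matrix.posSemidef_submatrix_equiv e1).2 posSemidefO.2.2

/-! ### The lineage-O well: the slab hypotheses, from ★ #45's instance facts -/

/-- The per-channel sector hypothesis `hsecO` on the slab `|σ_e − σ*_e| ≤ 2·atan(1/4)` (as inside ★ #45's proof; certO has the same a, b). -/
theorem hsecO : ∀ e ξ, |ξ - (WSCC9SP.relLurie D).δs e| ≤ (fun _ : Fin 8 => 2 * Real.arctan ((1 / 4 : ℚ) : ℝ)) e →
    certO.a e ≤ Real.cos ξ ∧ Real.cos ξ ≤ certO.b e := by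
  have hτ1 : ((tauV1 : ℚ) : ℝ) < 1 := by exact_mod_cast (show tauV1 < 1 by norm_num [tauV1])
  have hu0 : (0 : ℝ) < ((1 / 4 : ℚ) : ℝ) := by norm_num
  have hu1 : (((1 / 4 : ℚ)) : ℝ) ≤ 1 := by norm_num
  have hγpos : 0 ≤ 2 * Real.arctan (((1 / 4 : ℚ)) : ℝ) :=
    Lyapunov.StructurePreserving.two_mul_arctan_nonneg hu0.le
  have hθγ : 2 * Real.arctan ((tauV1 : ℚ) : ℝ) + 2 * Real.arctan (((1 / 4 : ℚ)) : ℝ) ≤ π :=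
    (two_arctan_add_lt_pi hτ1 hu1).le
  have ha' : ∀ e, certO.a e ≤ Real.cos (2 * Real.arctan ((tauV1 : ℚ) : ℝ) + 2 * Real.arctan (((1 / 4 : ℚ)) : ℝ)) :=
    fun e => by
    rw [cos_two_arctan_add]
    have hsc : ((slabSlope (1 / 4) : ℚ) : ℝ) = ((1 - ((tauV1 : ℚ) : ℝ) ^ 2) * (1 - (((1 / 4 : ℚ)) : ℝ) ^ 2)
        - 4 * ((tauV1 : ℚ) : ℝ) * ((1 / 4 : ℚ) : ℝ)) / ((1 + ((tauV1 : ℚ) : ℝ) ^ 2) * (1 + (((1 / 4 : ℚ)) : ℝ) ^ 2)) := by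
      push_cast [slabSlope]
      ring
    rw [← hsc]; exact aO_le_slabSlope e
  exact Params.relLurie_slab_sector_of_window (p := WSCC9SP.params D) (r := ref) (gnode := gnode) (src := srcV)
    (tgt := tgtV) (wt := wt) (δs := δ₀) certO hγpos hθγ lineAngle_abs_le_theta ha' oneO_le_b

/-- The face hypothesis `hfrO`: the lineage-O ε-level `cOQ` lies below `V` on the frontier of the slab. -/
theorem hfrO : ∀ x ∈ frontier ((WSCC9SP.relLurie D).slab (fun _ : Fin 8 => 2 * Real.arctan ((1 / 4 : ℚ) : ℝ))),
    ((cOQ : ℚ) : ℝ) < certO.V x := by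
  have hu0 : (0 : ℝ) < ((1 / 4 : ℚ) : ℝ) := by norm_num
  have hγ0 : (0 : ℝ) ≤ ((97 / 200 : ℚ) : ℝ) := by norm_num
  have hγ : (((97 / 200 : ℚ)) : ℝ) ^ 2 * (1 + (((1 / 4 : ℚ)) : ℝ) ^ 2) ≤ 4 * (((1 / 4 : ℚ)) : ℝ) ^ 2 := by norm_num
  have hlt : (((97 / 200 : ℚ)) : ℝ) < 2 * Real.arctan (((1 / 4 : ℚ)) : ℝ) := lt_two_arctan_of_sq_le hu0 hγ0 hγ
  have hcO' : ∀ _e : Fin 8, 2 * ((cOQ : ℚ) : ℝ) < certO.ε * (2 * Real.arctan (((1 / 4 : ℚ)) : ℝ)) ^ 2 := fun _ => by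
    have hsq : (((97 / 200 : ℚ)) : ℝ) ^ 2 < (2 * Real.arctan (((1 / 4 : ℚ)) : ℝ)) ^ 2 :=
      pow_lt_pow_left₀ hlt hγ0 two_ne_zero
    have := mul_lt_mul_of_pos_left hsq certO.ε_pos
    linarith [hcO]
  exact Params.relLurie_lt_V_frontier_slab_of_eps (p := WSCC9SP.params D) (r := ref) (gnode := gnode) (src := srcV)
    (tgt := tgtV) (wt := wt) (δs := δ₀) certO hsecO hcO'

/-! ### The rate sentence -/

/-- **«G2.b-SP9-SLAB-RATE-OPT» — the optimised certified decay time constant (lineage O) on ★ #45's object and class.** For MODEL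
M′_D = `(WSCC9SP.params D).phaseField` (as ★ #45) and CLASS C_O = the lineage-O certified well: from every phase point `y` whose 8 listed
line-angle deviations satisfy `|σ_e − σ*_e| ≤ 97/200` and whose relative state has `V_O ≤ cOQ = 442223/41943040000`, EVERY solution
`X` with `X 0 = y` has relative state `x(t) = relState(X t)` obeying
`‖x(t)‖₂ ≤ √(p₂/ε)·‖x(0)‖₂·e^{−(η/(2p₂))·t}` for all `t ≥ 0`, with `p₂ = 10703/1024`, `ε = 47/524288`, `η = 1/50`: a certified
decay TIME CONSTANT `2p₂/η = 267575/256 ≈ 1045` (model seconds) and amplitude factor `√(p₂/ε) = √(5479936/47) ≈ 341` inside the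
region — SUFFICIENT, NOT SHARP (Khalil Thm 4.10 shape with the certificate's feasibility-grade η). CERTIFIED for M′_D and C;
MODELLED as ★ #45 verbatim; VALIDATED: any simulated decay of M′, juxtaposed. Never «the grid damps oscillations in T seconds».
[cite: Khalil2002, Theorem 4.10; Pai1981, §2.16 Theorem [18] eq. (2.63); VuTuritsyn2017, §4.3 Theorem 1] -/
theorem sp9O_slab_rate {y : (Fin 9 → ℝ) × (Fin 9 → ℝ)}
    (hy : ∀ e, |(y.1 (srcV e) - y.1 (tgtV e)) - (δ₀ (srcV e) - δ₀ (tgtV e))| ≤ ((97 / 200 : ℚ) : ℝ))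
    (hyc : certO.V (relState ref gnode δ₀ y) ≤ ((cOQ : ℚ) : ℝ))
    {X : ℝ → (Fin 9 → ℝ) × (Fin 9 → ℝ)} (hX0 : X 0 = y)
    (hX : ∀ T : ℝ, ∀ t ∈ Icc 0 T, HasDerivWithinAt X ((WSCC9SP.params D).phaseField (X t)) (Icc 0 T) t)
    {t : ℝ} (ht : 0 ≤ t) :
    Real.sqrt (relState ref gnode δ₀ (X t) ⬝ᵥ relState ref gnode δ₀ (X t))
      ≤ Real.sqrt ((p2OQ : ℝ) / certO.ε) * Real.sqrt (relState ref gnode δ₀ (X 0) ⬝ᵥ relState ref gnode δ₀ (X 0))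
        * Real.exp (-(certO.η / (2 * (p2OQ : ℝ))) * t) := by
  subst hX0
  have hu0 : (0 : ℝ) < ((1 / 4 : ℚ) : ℝ) := by norm_num
  have hγ0 : (0 : ℝ) ≤ ((97 / 200 : ℚ) : ℝ) := by norm_num
  have hγ : (((97 / 200 : ℚ)) : ℝ) ^ 2 * (1 + (((1 / 4 : ℚ)) : ℝ) ^ 2) ≤ 4 * (((1 / 4 : ℚ)) : ℝ) ^ 2 := by norm_num
  have hlt : (((97 / 200 : ℚ)) : ℝ) < 2 * Real.arctan (((1 / 4 : ℚ)) : ℝ) := lt_two_arctan_of_sq_le hu0 hγ0 hγ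
  have h0 : ∀ e, |((X 0).1 (srcV e) - (X 0).1 (tgtV e)) - (δ₀ (srcV e) - δ₀ (tgtV e))|
      < (fun _ : Fin 8 => 2 * Real.arctan ((1 / 4 : ℚ) : ℝ)) e := fun e => (hy e).trans_lt hlt
  have hy' : relState ref gnode δ₀ (X 0) ∈ (WSCC9SP.relLurie D).slab (fun _ : Fin 8 => 2 * Real.arctan ((1 / 4 : ℚ) : ℝ)) :=
    (Params.mem_slab_relState_iff (WSCC9SP.params D) ref gnode srcV tgtV wt δ₀ _ (X 0)).2 h0
  have hrel : ∀ T : ℝ, ∀ s ∈ Icc 0 T, HasDerivWithinAt (fun τ => relState ref gnode δ₀ (X τ))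
      ((WSCC9SP.relLurie D).field (relState ref gnode δ₀ (X s))) (Icc 0 T) s :=
    fun T s hs => Params.hasDerivWithinAt_relState (wellFormed hD) ref_gnode.1 ref_gnode.2 mem_genS_iff
      (params_b_eq D) (pe_δ₀_eq_P0 D) (hX T s hs)
  have hp : (0 : ℝ) < (p2OQ : ℝ) := by exact_mod_cast scalarsO.2.2.2.1
  exact certO.sqrt_dotProduct_le_of_well hsecO hfrO hp upperO_posSemidef hrel hy' hyc ht

/-- **The squared form** (Khalil (4.20) before taking roots): `‖x(t)‖² ≤ (p₂/ε)·‖x(0)‖²·e^{−(η/p₂)·t}`. Same MODEL, CLASS, columns.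
[cite: Khalil2002, Theorem 4.10; Pai1981, §2.16 Theorem [18] eq. (2.63)] -/
theorem sp9O_slab_rate_sq {y : (Fin 9 → ℝ) × (Fin 9 → ℝ)}
    (hy : ∀ e, |(y.1 (srcV e) - y.1 (tgtV e)) - (δ₀ (srcV e) - δ₀ (tgtV e))| ≤ ((97 / 200 : ℚ) : ℝ))
    (hyc : certO.V (relState ref gnode δ₀ y) ≤ ((cOQ : ℚ) : ℝ))
    {X : ℝ → (Fin 9 → ℝ) × (Fin 9 → ℝ)} (hX0 : X 0 = y)
    (hX : ∀ T : ℝ, ∀ t ∈ Icc 0 T, HasDerivWithinAt X ((WSCC9SP.params D).phaseField (X t)) (Icc 0 T) t)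
    {t : ℝ} (ht : 0 ≤ t) :
    relState ref gnode δ₀ (X t) ⬝ᵥ relState ref gnode δ₀ (X t)
      ≤ (p2OQ : ℝ) / certO.ε * (relState ref gnode δ₀ (X 0) ⬝ᵥ relState ref gnode δ₀ (X 0))
        * Real.exp (-(certO.η / (p2OQ : ℝ)) * t) := by
  subst hX0
  have hu0 : (0 : ℝ) < ((1 / 4 : ℚ) : ℝ) := by norm_num
  have hγ0 : (0 : ℝ) ≤ ((97 / 200 : ℚ) : ℝ) := by norm_num
  have hγ : (((97 / 200 : ℚ)) : ℝ) ^ 2 * (1 + (((1 / 4 : ℚ)) : ℝ) ^ 2) ≤ 4 * (((1 / 4 : ℚ)) : ℝ) ^ 2 := by norm_num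
  have hlt : (((97 / 200 : ℚ)) : ℝ) < 2 * Real.arctan (((1 / 4 : ℚ)) : ℝ) := lt_two_arctan_of_sq_le hu0 hγ0 hγ
  have h0 : ∀ e, |((X 0).1 (srcV e) - (X 0).1 (tgtV e)) - (δ₀ (srcV e) - δ₀ (tgtV e))|
      < (fun _ : Fin 8 => 2 * Real.arctan ((1 / 4 : ℚ) : ℝ)) e := fun e => (hy e).trans_lt hlt
  have hy' : relState ref gnode δ₀ (X 0) ∈ (WSCC9SP.relLurie D).slab (fun _ : Fin 8 => 2 * Real.arctan ((1 / 4 : ℚ) : ℝ)) :=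
    (Params.mem_slab_relState_iff (WSCC9SP.params D) ref gnode srcV tgtV wt δ₀ _ (X 0)).2 h0
  have hrel : ∀ T : ℝ, ∀ s ∈ Icc 0 T, HasDerivWithinAt (fun τ => relState ref gnode δ₀ (X τ))
      ((WSCC9SP.relLurie D).field (relState ref gnode δ₀ (X s))) (Icc 0 T) s :=
    fun T s hs => Params.hasDerivWithinAt_relState (wellFormed hD) ref_gnode.1 ref_gnode.2 mem_genS_iff
      (params_b_eq D) (pe_δ₀_eq_P0 D) (hX T s hs)
  have hp : (0 : ℝ) < (p2OQ : ℝ) := by exact_mod_cast scalarsO.2.2.2.1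
  exact certO.dotProduct_le_mul_exp_neg_of_well hsecO hfrO hp upperO_posSemidef hrel hy' hyc ht

/-- The two certified constants as exact rationals: time constant `2p₂/η = 267575/256` and squared amplitude `p₂/ε = 5479936/47`
(so the amplitude factor is `√(5479936/47)`). -/
theorem rateO_constants : 2 * p2OQ / etaOQ = 267575 / 256 ∧ p2OQ / epsOQ = 5479936 / 47 :=
  ⟨scalarsO.2.2.2.2.1, scalarsO.2.2.2.2.2⟩

end Summit.Ventures.GridStability.Bench.WSCC9SP9SlabORate

end
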